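import Summits.CriticalPhenomena.PercolationContinuityZ3.Theorems.PercNearOneGluingNoHeavyQuantEffectiveTargetLemma
import Literature.Probability.Percolation.KozmaNitzanCorridor
import HarnessLib

/-!
# QUANT lane (R2, step S3a): Kozma–Nitzan's Lemma 11 with LINEAR bookkeeping — the level chain and the
# elongated-box hittability from scale-indexed inputs

builds on p205010 (kernel theorem, internal audit signed; external expert review pending)

Cell `prim-quant` (post-continuity programme, LANE 1), seat `prim-quant-p2` (METHOD = effective Kozma–Nitzan
reduction), memo `run/shared/lean/prim/quant/P2-EFFECTIVE-KN.md` §2 (L11-add), Lean step S3a.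

The tree's Lemma 11 (`KozmaNitzan.isHittable_elongGeom_of_target`, `…/KozmaNitzanCorridor.lean`) chains
`N = 8K − 4` applications of the target property (`EData.levelChain_of_target`, an induction in which each level
consumes the `δ` of the next: `ε_{i+1} = δ(ε_i)`), producing a TOWER of tolerances when `δ(ε) = ε²/48`
(QUANT.md §3).  With the LINEAR target property delivered by additive gluing
(`Quant.targetLemma_additive`: `∀ δ', TargetPropertyAt d p (δ' + η) δ' H R`, packaged here as
`Quant.targetPropertyAt_linear_of_scales`) the same chain ADDS the losses:

* `Quant.levelStep_linear`, `Quant.levelChain_linear` — `1 − δ' < P_Ω(0 ↔ face_0)` gives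
  `1 − (δ' + N·η) < P_Ω(0 ↔ face_N)` for every admissible chain (`EData.ChainOK`), from the single hypothesis
  `hT : ∀ δ', TargetPropertyAt d p (δ' + η) δ' (qfList d) R₀` (no `TargetProperty`, no `θ(p) > 0`);
* `Quant.elongHit_linear` — Lemma 11 with scale-indexed inputs: if moreover the seed box `Λ_k` is linked to every
  face orthant of `Λ_n` inside `Λ_n` with probability `> 1 − δ'` for all `n ∈ [n₁, r]` (KN Lemma 9 on a BOUNDED
  range), then for `r ≥ 8(3K + 3KR₀ + k + n₁ + 8)` and `m ≥ k` the elongated box of aspect `K` is hit from `Λ_m`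
  at scale `r` with probability `> 1 − (δ' + (8K−4)·η)` — loss LINEAR in `K`.

Same geometry as the tree proofs (`EData.isTarget_step`, `EData.real_W_biUnion_openConn`, …), only the
bookkeeping changes.  No definitions; no sorries; standard axioms.
[cite: KozmaNitzan2024, §4 Lemma 11 (pp. 22–23)]
-/

noncomputable section

namespace Summit.CriticalPhenomena.PercolationContinuityZ3.Theorems.Quant

open MeasureTheory Literature.Probability.LatticeModels Literature.Probability.Percolation
  Literature.Probability.Percolation.KozmaNitzan

variable {d : ℕ}

/-- **The linear family of target properties from the scales**: under the hypotheses (a)–(e) of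
`targetLemma_additive_core` (tolerance `δ`), `TargetPropertyAt d p (δ' + 6δ) δ' H R` holds for EVERY `δ'`
(additive loss `6δ`, arbitrary input defect `δ'`).
builds on p205010 (kernel theorem, internal audit signed; external expert review pending).
[cite: KozmaNitzan2024, §4 Lemma 10 (pp. 17–22)] -/
theorem targetPropertyAt_linear_of_scales [NeZero d] (p : unitInterval) (hp1 : (p : ℝ) < 1)
    {δ : ℝ} (hδ : 0 < δ) (H : List (Geom d)) {m M ℓmax k R : ℕ} (hmM : m < M)
    (hhit : ∀ g ∈ H, ∀ ℓ : ℕ, ℓmax ≤ ℓ →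
      1 - δ ^ 2 < (bondPercolation (zdGraph d) p).real (linkIn (↑(g.Qset ℓ 0)) (box d m) (g.Fset ℓ 0)))
    (hface : ∀ (a : Fin d) (τ : Fin d → ℤˣ),
      1 - δ ^ 2 < (bondPercolation (zdGraph d) p).real (linkEvent (box d m) (orthantFace a τ M) M))
    (huniq : 1 - δ ^ 2 < (bondPercolation (zdGraph d) p).real (uniqZone m M))
    (hk : (1 - (p : ℝ) ^ seedBound d M) ^ k ≤ δ)
    (hR : 3 * M + ℓmax + 4 + ⌈(1 / (1 - (p : ℝ)) ^ (2 * d * LData.Ncont d M k)) / δ⌉₊ ≤ R) (δ' : ℝ) :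
    TargetPropertyAt d p (δ' + 6 * δ) δ' H R := by
  intro W Sfin D lo hi T o hfin hsub hDS ho hoD hBR htgt hTD hTne hreach
  have h := targetLemma_additive p hp1 hδ H hmM hhit hface huniq hk hR W Sfin D lo hi T o hfin hsub hDS ho hoD hBR
    htgt hTD hTne
  linarith

/-! ## The level chain with linear loss -/

/-- **One step of Lemma 11, linear form**: for an admissible step (`EData.StepOK E R₀ R L s w`) and a linear
family of target properties for the quarter-face geometries with margin `R₀` and loss `η`,
`1 − δ' < P_Ω(0 ↔ face(L, w))` implies `1 − (δ' + η) < P_Ω(0 ↔ face(L+s, w+R))` (the tree's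
`EData.levelStep_of_target`, same geometric inputs).
builds on p205010 (kernel theorem, internal audit signed; external expert review pending).
[cite: KozmaNitzan2024, §4 pp. 22–23] -/
theorem levelStep_linear [NeZero d] (p : unitInterval) {η : ℝ} {R₀ : ℕ}
    (hT : ∀ δ' : ℝ, TargetPropertyAt d p (δ' + η) δ' (qfList d) R₀)
    (E : EData d) (R : ℕ) (L s w : ℤ) (hok : EData.StepOK E R₀ R L s w) {δ' : ℝ}
    (hB : 1 - δ' < (prodBernoulli (E.W p)).real (⋃ b ∈ E.face L w, openConn (0 : Site d) b)) :
    1 - (δ' + η) < (prodBernoulli (E.W p)).real (⋃ b ∈ E.face (L + s) (w + R), openConn (0 : Site d) b) :=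
  hT δ' (E.W p) E.bigBox (E.region L s) (sLo E.a E.σ 0 L L w) (sHi E.a E.σ 0 L L w)
    (E.face (L + s) (w + R)) 0 (E.finSupp_W p hok.hkr hok.hK1) (EData.isSubbox_region hok p)
    (EData.region_subset_bigBox hok) E.zero_mem_bigBox (EData.zero_not_mem_region hok)
    (EData.enlarge_face_subset_region hok) (EData.isTarget_step hok) (EData.face_subset_region hok)
    (EData.face_nonempty hok) hB

/-- **The chain of Lemma 11, linear form**: `N` admissible steps (`EData.ChainOK E R₀ R N L s w`) turn
`1 − δ' < P_Ω(0 ↔ face(L, w))` into `1 − (δ' + N·η) < P_Ω(0 ↔ face(L + Ns, w + NR))` — the losses ADD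
(the tree's `EData.levelChain_of_target` nests them).
builds on p205010 (kernel theorem, internal audit signed; external expert review pending).
[cite: KozmaNitzan2024, §4 p. 23] -/
theorem levelChain_linear [NeZero d] (p : unitInterval) {η : ℝ} {R₀ : ℕ}
    (hT : ∀ δ' : ℝ, TargetPropertyAt d p (δ' + η) δ' (qfList d) R₀) (N : ℕ) :
    ∀ (E : EData d) (R : ℕ) (L s w : ℤ), EData.ChainOK E R₀ R N L s w → ∀ {δ' : ℝ},
      1 - δ' < (prodBernoulli (E.W p)).real (⋃ b ∈ E.face L w, openConn (0 : Site d) b) →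
        1 - (δ' + N * η) < (prodBernoulli (E.W p)).real
          (⋃ b ∈ E.face (L + N * s) (w + N * R), openConn (0 : Site d) b) := by
  induction N with
  | zero =>
    intro E R L s w _ δ' hB
    simpa using hB
  | succ N ih =>
    intro E R L s w hok δ' hB
    have step := levelStep_linear p hT E R L s w (hok.stepOK hok.hR) hB
    have rest := ih E R (L + s) s (w + R) hok.shift step
    have e1 : L + s + (N : ℤ) * s = L + ((N + 1 : ℕ) : ℤ) * s := by push_cast; ring
    have e2 : w + (R : ℤ) + (N : ℤ) * R = w + ((N + 1 : ℕ) : ℤ) * R := by push_cast; ring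
    have e3 : δ' + η + (N : ℝ) * η = δ' + ((N + 1 : ℕ) : ℝ) * η := by push_cast; ring
    rw [e1, e2, e3] at rest
    exact rest

/-! ## Lemma 11 with scale-indexed inputs -/

/-- **Kozma–Nitzan's Lemma 11 with LINEAR loss and scale-indexed inputs.**  Data: direction `a`, sign `σ`,
aspect `K ≥ 2`, a linear family of target properties for the quarter faces (margin `R₀`, loss `η`), a seed
radius `k` and a threshold `n₁`.  If `Λ_k` is joined inside `Λ_n` to every face orthant of `Λ_n` with probability
`> 1 − δ'` for every `n ∈ [n₁, r]` (KN Lemma 9 on a bounded range), then for every `r ≥ 8(3K + 3KR₀ + k + n₁ + 8)`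
and every `m ≥ k`, the elongated box `{-r ≤ σx_a ≤ Kr, |x_j| ≤ r}` is crossed from `Λ_m` to its far face
`{σ x_a = Kr}` with probability `> 1 − (δ' + (8K−4)·η)`.  Proof: the tree's proof of
`isHittable_elongGeom_of_target` (start from the full face of `Λ_{L₀}`, `L₀ = Kr − (8K−4)⌊r/8⌋ ≤ r`, reached from
`Λ_k`; `8K − 4` steps of `levelChain_linear` in `Ω`; back to `P_p` by `EData.real_W_biUnion_openConn`).
builds on p205010 (kernel theorem, internal audit signed; external expert review pending).
[cite: KozmaNitzan2024, §4 Lemma 11 (pp. 22–23)] -/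
theorem elongHit_linear [NeZero d] (p : unitInterval) {η : ℝ} {R₀ : ℕ}
    (hT : ∀ δ' : ℝ, TargetPropertyAt d p (δ' + η) δ' (qfList d) R₀)
    (a : Fin d) (σ : ℤˣ) (K : ℕ) (hK : 2 ≤ K) {k n₁ r m : ℕ} {δ' : ℝ}
    (hlink : ∀ n : ℕ, n₁ ≤ n → n ≤ r → ∀ (a' : Fin d) (τ : Fin d → ℤˣ),
      1 - δ' < (bondPercolation (zdGraph d) p).real (linkEvent (box d k) (orthantFace a' τ n) n))
    (hr : 8 * (3 * K + 3 * K * R₀ + k + n₁ + 8) ≤ r) (hm : k ≤ m) :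
    1 - (δ' + (8 * K - 4 : ℕ) * η) < (bondPercolation (zdGraph d) p).real
      (linkIn (↑((elongGeom a σ K (by omega)).Qset r 0)) (box d m) ((elongGeom a σ K (by omega)).Fset r 0)) := by
  have hK1 : 1 ≤ K := by omega
  set N : ℕ := 8 * K - 4 with hNdef
  have hN : (N : ℤ) = 8 * K - 4 := by rw [hNdef]; omega
  set A : ℕ := 3 * K + 3 * K * R₀ + k + n₁ + 8 with hAdef
  rw [elongGeom_Qset a σ K hK1 k r, elongGeom_Fset a σ K hK1 k r]
  -- the parameters of the chain
  set s : ℕ := r / 8 with hsdef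
  have hs1 : 8 * s ≤ r := Nat.mul_div_le r 8
  have hs2 : r < 8 * s + 8 := by
    have := Nat.div_add_mod r 8; have := Nat.mod_lt r (show 0 < 8 by norm_num); omega
  have hAs : A ≤ s := by
    rw [hsdef]; exact (Nat.le_div_iff_mul_le (by norm_num)).2 (by linarith)
  set E : EData d := elongData a σ K r k with hE
  set L₀ : ℤ := K * r - N * s with hL₀
  -- casts
  have hK' : (2 : ℤ) ≤ K := by exact_mod_cast hK
  have hs1' : 8 * (s : ℤ) ≤ r := by exact_mod_cast hs1
  have hs2' : (r : ℤ) < 8 * s + 8 := by exact_mod_cast hs2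
  have hAs' : (A : ℤ) ≤ s := by exact_mod_cast hAs
  have hA' : (A : ℤ) = 3 * K + 3 * K * R₀ + k + n₁ + 8 := by rw [hAdef]; push_cast; ring
  have hKr1 : (K : ℤ) * (8 * s) ≤ K * r := mul_le_mul_of_nonneg_left hs1' (by positivity)
  have hKr2 : (K : ℤ) * r ≤ K * (8 * s + 8) := mul_le_mul_of_nonneg_left hs2'.le (by positivity)
  have hKR0 : (0 : ℤ) ≤ K * R₀ := by positivity
  have hNs : (N : ℤ) * s = 8 * (K * s) - 4 * s := by rw [hN]; ring
  have hNR : (N : ℤ) * R₀ = 8 * (K * R₀) - 4 * R₀ := by rw [hN]; ring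
  have hKR : (R₀ : ℤ) ≤ K * R₀ := by
    have : (1 : ℤ) * R₀ ≤ K * R₀ := mul_le_mul_of_nonneg_right (by linarith) (by positivity)
    linarith
  have hrK : (r : ℤ) ≤ K * r := by
    have : (1 : ℤ) * r ≤ K * r := mul_le_mul_of_nonneg_right (by linarith) (by positivity)
    linarith
  have hL₀lo : 4 * (s : ℤ) ≤ L₀ := by rw [hL₀]; linarith
  have hL₀hi : L₀ ≤ 4 * (s : ℤ) + 8 * K := by rw [hL₀]; linarith
  have hL₀r : L₀ ≤ r := by linarith
  -- the chain conditions
  have hok : EData.ChainOK E R₀ R₀ N L₀ s L₀ :=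
    { hR := le_rfl
      hs := by linarith
      hw := by linarith
      hr := by
        show L₀ + (N : ℤ) * R₀ + s + 2 * R₀ ≤ (r : ℤ)
        linarith
      hk := by
        show ((k : ℕ) : ℤ) < L₀ - 2 * s
        linarith
      hK := by
        show L₀ + (N : ℤ) * s ≤ (K : ℤ) * r
        rw [hL₀]; linarith
      hkr := by
        show k ≤ r
        have : (k : ℤ) ≤ r := by linarith
        exact_mod_cast this
      hK1 := by show 1 ≤ K; omega }
  -- the initial face: a full face of the cube `Λ_{L₀}` is reached from `Λ_k` (hypothesis `hlink`)
  have hL₀0 : 0 ≤ L₀ := by linarith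
  set L₀' : ℕ := L₀.toNat with hL₀'
  have hL₀cast : (L₀' : ℤ) = L₀ := Int.toNat_of_nonneg hL₀0
  have hn₁ : n₁ ≤ L₀' := by
    have : (n₁ : ℤ) ≤ L₀' := by rw [hL₀cast]; linarith
    exact_mod_cast this
  have hL₀'r : L₀' ≤ r := by
    have : (L₀' : ℤ) ≤ r := by rw [hL₀cast]; exact hL₀r
    exact_mod_cast this
  set τ₀ : Fin d → ℤˣ := fun _ => σ with hτ₀
  have hinit : 1 - δ' < (prodBernoulli (E.W p)).real (⋃ b ∈ E.face L₀ L₀, openConn (0 : Site d) b) := by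
    rw [E.real_W_biUnion_openConn p hok.hkr hok.hK1]
    refine (hlink L₀' hn₁ hL₀'r a τ₀).trans_le (measureReal_mono ?_ (measure_ne_top _ _))
    rintro ω ⟨y, hy, x, hx, hω⟩
    simp only [Set.mem_iUnion, exists_prop, Finset.mem_coe]
    refine ⟨x, ?_, y, hy, ?_⟩
    · -- the face orthant lies on the full face
      rw [mem_orthantFace, mem_box] at hx
      obtain ⟨hxb, hxa, -⟩ := hx
      rw [EData.mem_face_iff]
      refine ⟨?_, fun j _ => ?_⟩
      · change (σ : ℤ) * x a = L₀
        rw [← hL₀cast, ← hxa]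
      · have := hxb j; rw [hL₀cast] at this; exact this
    · -- `Λ_{L₀} ⊆` the elongated box
      rw [DCT16.mem_openConnIn_iff_pathIn] at hω ⊢
      refine hω.mono fun z hz => ?_
      rw [Finset.mem_coe, mem_box] at hz
      rw [Finset.mem_coe, EData.mem_bigBox_iff]
      have hza := level_bounds_of_symm E.hσ (hz a).1 (hz a).2
      change (-(r : ℤ) ≤ E.σ * z a ∧ E.σ * z a ≤ K * r) ∧ ∀ j, j ≠ a → -(r : ℤ) ≤ z j ∧ z j ≤ r
      rw [hL₀cast] at hza
      refine ⟨⟨by linarith [hza.1], by linarith [hza.2]⟩, fun j _ => ?_⟩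
      have := hz j; rw [hL₀cast] at this
      constructor <;> linarith [this.1, this.2]
  -- the chain
  have hend := levelChain_linear p hT N E R₀ L₀ s L₀ hok hinit
  have hlev : L₀ + (N : ℤ) * s = r * K := by rw [hL₀]; ring
  rw [hlev, E.real_W_biUnion_openConn p hok.hkr hok.hK1] at hend
  -- back to the geometry
  have hwid : L₀ + (N : ℤ) * R₀ ≤ r := by
    have h1 : L₀ + (N : ℤ) * R₀ + s + 2 * R₀ ≤ (r : ℤ) := hok.hr
    have h2 : (0 : ℤ) ≤ s := by positivity
    have h3 : (0 : ℤ) ≤ R₀ := by positivity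
    linarith
  refine hend.trans_le (measureReal_mono ?_ (measure_ne_top _ _))
  intro ω hω
  simp only [Set.mem_iUnion, exists_prop, Finset.mem_coe] at hω
  obtain ⟨t, ht, y, hy, hω⟩ := hω
  refine ⟨y, box_mono d hm hy, t, ?_, hω⟩
  rw [EData.mem_face_iff] at ht ⊢
  refine ⟨ht.1, fun j hj => ?_⟩
  have h2 := ht.2 j hj
  change -(r : ℤ) ≤ t j ∧ t j ≤ r
  constructor <;> linarith [h2.1, h2.2]

end Summit.CriticalPhenomena.PercolationContinuityZ3.Theorems.Quant

end
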